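import Mathlib
import HarnessLib
import HarnessLib.Audit
import Summits.ValiantsHypothesis.Statement
import Literature.Computability.AlgebraicComplexity.SymmetricArithCircuit
import Literature.Computability.AlgebraicComplexity.PIProof
import HarnessLib.Audit.Status.Attr

/-!
Route: ProofCarryingSymmetry

DORMANT since 2026-08-26T00:47:49Z (reconciler: no traction for 8.2 d (last activity item-evidence-added at 2026-08-17T19:20:05Z); parked, not closed — `ledger route dormant route-ValiantsHypothesis-ProofCarryingSymmetry --off` to react) — unstaffed, not closed; items shared with open routes are served there. `ledger route dormant <id> --off` reactivates.

# Route ProofCarryingSymmetry — proof-carrying symmetry — a small circuit for per_n could not prove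
its own S_n-invariance; restoration split into PI-provability and Ulam-type stability over
Dawar–Wilsenach

It suffices to show X = ANCHOR ∧ RESTORATION (card proof-carrying-symmetry, layer 1). ANCHOR
(`SquareSymmetricPermLB`) is
Dawar–Wilsenach's theorem (DawarWilsenach2025 Thm 7.1, size corollary): no family of S_n-symmetric
arithmetic circuits over ℂ
(S_n acting diagonally, x_ij ↦ x_{σi σj} — "square-symmetric" in the ToC terminology; symmetric =
every σ extends to a circuit
automorphism, tree `LabelledArithCircuit.IsSymmetric`) computes per_n in size 2^{o(n)}; it is a
published theorem not yet in Lean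
and therefore filed as the first crux. RESTORATION (`RestorationQP`): every p-family of diagonally
S_n-invariant polynomials in
the n×n variable matrix that lies in VP_ℂ has S_n-symmetric circuits of quasi-polynomial TOTAL size.
X ⇒ per ∉ VP (per is
invariant and in VNP) ⇒ VP_ℂ ≠ VNP_ℂ. The card's mechanism is the planned LAYER-2 split of
RESTORATION by the PROOF COMPLEXITY
OF INVARIANCE: PROVABILITY T (a small circuit can prove its own symmetry: qp-size Hrubeš–Tzameret
P_c-proofs of C∘τ = C for
the adjacent transpositions τ) and STABILITY L (short invariance proofs ⇒ a genuinely symmetric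
circuit of size poly(|C|, t, n)
computing the same polynomial — the Ulam/Kazhdan "almost-action ⇒ nearby action" statement on the
rewrite graph); both are
filed as informal cruxes at open and typed once the definition item PIProof (HT's P_c/P_f with
per-axiom counts) lands; with
them the per-line L ∧ T_per ∧ ANCHOR ⇒ VH bypasses RESTORATION entirely.
Lean: `(∀ (G : ℕ → Type) [∀ n, Fintype (G n)] (C : ∀ n,
Literature.Computability.AlgebraicComplexity.LabelledArithCircuit ℂ (Fin n × Fin n) Unit (G n)), (∀
n, (C n).IsSymmetric (Equiv.Perm (Fin n))) → (∀ n, (C n).eval ((C n).output ()) =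
Literature.Computability.AlgebraicComplexity.perPoly (Fin n) ℂ) → ∃ ε : ℝ, 0 < ε ∧ ∀ n₀ : ℕ, ∃ n ≥
n₀, (2 : ℝ) ^ (ε * n) ≤ Fintype.card (G n)) ∧ (∀ f : (n : ℕ) → MvPolynomial (Fin n × Fin n) ℂ, (∀ (n
: ℕ) (σ : Equiv.Perm (Fin n)), MvPolynomial.rename (fun x : Fin n × Fin n => σ • x) (f n) = f n) →
Literature.Computability.AlgebraicComplexity.IsVPFamily f → ∃ c : ℕ, ∀ n : ℕ, ∃ (G : Type) (_ :
Fintype G) (C : Literature.Computability.AlgebraicComplexity.LabelledArithCircuit ℂ (Fin n × Fin n)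
Unit G), C.IsSymmetric (Equiv.Perm (Fin n)) ∧ C.eval (C.output ()) = f n ∧ Fintype.card G ≤ 2 ^
((Nat.log 2 n + c) ^ c))`

## Assembly
Bookkeeping, type-checked sorry-free modulo two routine lemmas in the planner's AssemblyCheck.lean
(per_n is invariant under the
diagonal relabelling — reindex the permutation sum by conjugation; and 2^{(log₂ n + c)^c} < 2^{εn}
eventually, e.g. from Mathlib's
`Real.tendsto_pow_log_div_mul_add_atTop`): assume VP_ℂ = VNP_ℂ; `perFamily_mem_VNP_holds ℂ` and
`mem_VP_ofFintype_iff_holds` give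
`IsVPFamily (fun n => perPoly (Fin n) ℂ)`; RestorationQP yields symmetric circuits of size ≤
2^{(log₂ n+c)^c} for all n (choice
turns `∀ n, ∃ G …` into a family); SquareSymmetricPermLB gives ε > 0 and arbitrarily large n with
2^{εn} ≤ size — contradiction;
hence ¬IsVPFamily per and `Summit.ValiantsHypothesis.Hub.valiantsHypothesis_of_not_isVPFamily_per`
closes. The deciding theorem is
`closes := h_Assembly h_SquareSymmetricPermLB h_RestorationQP`.

Rationale: WHY THIS LINE. The only super-polynomial lower bound for general-depth circuits computing per_n that
assumes nothing about degree, depth or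
monotonicity is Dawar–Wilsenach's for SYMMETRIC circuits (DawarWilsenach2025 Thm 7.1: orbit size
2^{Ω(n)} infinitely often,
char 0, via Cai–Fürer–Immerman graphs and counting width; det has O(n⁴)-size symmetric circuits by
Le Verrier, Thm 4.1), and
Dwivedi–Pago–Seppelt (DwivediPagoSeppelt2026, Outlook Q3; DawarPagoSeppelt2025 Thm 1.1) leave open
whether symmetry can always
be restored for invariant VP families — restoration ∧ DW ⇒ VH. The card meters the gap by PROOF
LENGTH rather than by subgroup
(beat-the-group-order) or Weisfeiler–Leman dimension (symmetry-restoration-wl): a circuit for an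
invariant polynomial satisfies
the identities C∘τ = C, Hrubeš–Tzameret equational proofs (HrubesTzameret2009; HrubesTzameret2015 =
arXiv:1112.6265 §1, systems
P_f/P_c, sound and complete, p-boundedness open) derive them from the ring axioms, and zero proof
length is exactly DW's syntactic
symmetry; so restoration splits into a p-boundedness statement for the most structured identities in
algebraic proof complexity
(T) and a stability statement (L) importing the Ulam/Kazhdan "ε-homomorphism ⇒ nearby homomorphism"
paradigm
(DeChiffreGlebskyLubotzkyThom2017: stability ⇔ vanishing of a second cohomology) with the dictionary
group S_n ↦ relabelling
action on circuits modulo AC, ε-homomorphism ↦ rewrite paths C →≤t C∘τ for the generators, nearby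
homomorphism ↦ a symmetric
circuit O(t)-close. Imported areas: proof complexity (HT), finite model theory (DW's engine),
geometric group theory
(stability); calibration: det has both short proofs of its identities (HrubesTzameret2015,
Tzameret–Cook arXiv:1811.04313) and
small symmetric circuits. Nothing in the negatives index (3 refuted statements: Elusive candidate,
Grenet uniqueness ×2) is used.

RANKED CRUXES. #2 SquareSymmetricPermLB (crux) — Dawar–Wilsenach's lower bound, size form over ℂ
(DawarWilsenach2025 Thm 7.1, which bounds the maximal ORBIT size, a quantity ≤ size, so the printed
theorem is stronger): for every family (C_n) of S_n-symmetric labelled arithmetic circuits over ℂ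
(diagonal action on Fin n × Fin n, trivial on the single output; DW Defs 2.2, 3.6, 3.7 = tree
`LabelledArithCircuit`, `IsSymmetric`) with C_n computing per_n for every n, the size is not
2^{o(n)}: some ε > 0 has |C_n| ≥ 2^{εn} for infinitely many n. A published theorem, not yet a
Literature fact — filed FIRST so that it lands (as a Theorems proof or as a named fact the item is
then re-filed against) before provers are pointed at the rest. [difficulty: XL] (why it might fail:
Settled in print (ToC 2025); residual risk is transcription only — DW assume a unique sink and pass
via RIGID circuits (rigidification, AndersonDawar2016 Lem 7, is size-linear, orbit-preserving); our
IsSymmetric fixes the output gate — each difference only weakens the Lean form.)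
[DawarWilsenach2025, arXiv:2002.06451, AndersonDawar2016, DawarPagoSeppelt2025]
#3 RestorationQP (crux) — SYMMETRY RESTORATION AT QUASI-POLYNOMIAL COST (the layer-1 node the card's
T ∧ L split; shared with card symmetry-restoration-wl and DwivediPagoSeppelt2026 Outlook Q3, here
for the DIAGONAL S_n action and TOTAL size): for every family f_n ∈ ℂ[x_ij : i, j < n] with
f_n(x_{σi σj}) = f_n for all σ ∈ S_n and (f_n) ∈ VP (tree `IsVPFamily`: p-bounded variables/degree
and straight-line complexity), there is c with, for every n, an S_n-symmetric labelled circuit of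
size ≤ 2^{(log₂ n + c)^c} computing f_n. [difficulty: open-problem] (why it might fail: An
"arithmetic CFI": a diagonally invariant VP family that is not a qp-size combination of
bounded-treewidth hom polynomials (DawarPagoSeppelt2025 Thm 1.1) — e.g. a VP family of
unbounded-treewidth homs, which DPS26 Cor 3.6 excludes only if VFPT ≠ VW; Boolean precedent P ≠
FPC.) [DwivediPagoSeppelt2026, DawarPagoSeppelt2025, DawarWilsenach2025, Engels2020,
arXiv:2107.10986]
#9 DetCalibration (support) — CALIBRATION / NON-VACUITY (DawarWilsenach2025 Thm 4.1, Le Verrier's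
method; transpose-symmetric ⊇ diagonal): det_n has S_n-symmetric labelled circuits over ℂ of size
polynomial in n (the paper's family is computable in time O(n⁴)). Shows the symmetric model is
inhabited by a VP-complete-flavoured invariant family exactly where restoration can be checked, and
exercises `IsSymmetric` with ℚ-constants 1/k. [difficulty: M] [DawarWilsenach2025, arXiv:2002.06451]

TWO-LAYER PLAN. Filed right after open as INFORMAL cruxes (they need definition item PIProof =
Hrubeš–Tzameret P_c(ℂ)/P_f(ℂ) with line, size and
per-axiom-scheme counts; HrubesTzameret2015 §1): #4 StabilityOfProvableSymmetry (L): ∃ absolute c, ∀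
n s t and every fan-in-2
circuit C over ℂ of size s in x_ij computing f, if for each adjacent transposition τ_k = (k k+1) the
identity C∘τ_k = C (inputs
relabelled x_ij ↦ x_{τi τj}) has a P_c(ℂ)-proof of size ≤ t, then f has an S_n-symmetric labelled
circuit of size ≤ (s+t+n+2)^c
(strong form, later child: size s + c·t·n² when only distributivity A6 instances are metered and
A1–A5, C1, C2 are free — then
t = 0 is literally DW-symmetry up to AC); #5 PerInvarianceProvableQP (T_per): IsVPFamily per ⇒ ∃ c
and circuits C_n for per_n of
size ≤ 2^{(log₂ n+c)^c} whose n−1 invariance identities C_n∘τ_k = C_n have P_c(ℂ)-proofs of size ≤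
2^{(log₂ n+c)^c}. Foreseen
glued edits once both are typed: (a) support PerLineAssembly : SquareSymmetricPermLB →
StabilityOfProvableSymmetry →
PerInvarianceProvableQP → ValiantsHypothesis and re-certified `closes` through it (RestorationQP
then off the critical path);
(b) split RestorationQP ⇐ InvarianceProvableQP (T_gen: every diagonally invariant VP family has qp
circuits with qp invariance
proofs) → StabilityOfProvableSymmetry → RestorationQP (k = 2). Children of L later: the det test
case (HT12's proofs of
det(PXPᵀ) = det X for the Gaussian-elimination circuit end O(t)-close to a Le Verrier/clow
circuit?), the coherence lemma
(rewrite paths for τ_k, τ_{k+1} satisfy the braid relations up to short homotopies — the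
2-cell/cohomology obstruction), and the
functional relaxation via Engels2020 (a symmetric circuit agreeing with f on permutation monomials
suffices against per).

KILL CRITERIA. RestorationQP refuted by an explicit diagonally invariant VP family with no
2^{polylog} symmetric circuits ⇒ close
`refuted:RestorationQP` UNLESS L and T_per are typed by then — the per-line (a) survives a
general-restoration counterexample iff the
witness family has no short invariance proofs (then it is evidence FOR the proof-complexity dial,
and the route pivots to (a) by
`--drop RestorationQP`). L refuted (a circuit family with P_c-short invariance proofs but provably
no poly(s,t,n) symmetric circuit,
e.g. from DawarPagoSeppelt2025's treewidth characterisation applied to a hom family with short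
proofs) ⇒ the mechanism is dead:
close `refuted:StabilityOfProvableSymmetry`; the card's formula-side fallback (commutator budget
anchored on Nisan1991Noncommutative,
K3 of the card) would be a NEW route through VQF = VQP, not a repair. T_per refuted is impossible
short of proving per ∉ VP or a
PI lower bound (either is a celebrated theorem; record and close `superseded`).
SquareSymmetricPermLB cannot be refuted (theorem);
if it lands as a Literature named fact instead of a proof, re-file per grounder note. RestorationQP
PROVED elsewhere (e.g. by a
symmetry-restoration-wl route) closes this route's target too — shared decl.

NOT DECOMPOSED YET. The proof system itself (definition item PIProof; until it lands L and T stay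
informal and unstaffed); the axiom-metered strong
form of L (|C| + O(t n²)) and its coherence/braid lemma; T_gen; the formula/ABP variants (P_f
proofs, Nisan anchor, commutator
budget cb — a separate route if ever); the S_n×S_n-restricted weakening of RestorationQP
(hypothesis: invariance under independent
row and column permutations and transpose, conclusion unchanged — the fallback restatement if a
non-bipartite "arithmetic CFI"
kills the diagonal form); orbit size versus total size (DW and DPS work with orbit size; we use
total size deliberately, since
poly ORBIT size already contains VNP-hard families, DawarPagoSeppelt2025 Thm 3.1); constants (ℂ vs
ℚ) and the SLP-vs-DAG circuit
model conversion inside RestorationQP (routine, poly overhead).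

CHEAPEST FALSIFIER. For RestorationQP: search DawarPagoSeppelt2025 §3/§6 and DwivediPagoSeppelt2026
Table 1 for an UNCONDITIONAL example of a
matrix- /square-symmetric family in VP with super-quasi-polynomial symmetric (total-size) complexity
— the planner found only
conditional (VFPT ≠ VW) and orbit-size statements, and Outlook Q3 poses coincidence of symVP and VP
on matrix-symmetric polynomials
as open; a refuter should re-read Thm 3.1/Cor 3.6 with the diagonal action in mind (DPS's
"matrix-symmetric" = S_n × S_m). For the
mechanism (L): the card's own test — write HT12's P_c-proof of det_3(PXPᵀ) = det_3(X) for the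
Gaussian-elimination circuit as a
rewrite path and measure its distance to DW's Le Verrier circuit; a super-polynomial distance at
small n would force the weak
(poly(s,t,n)) form only. Not runnable here today: `lit search`/galaxy were unavailable (rc 75)
during planning; arXiv/Crossref
remote searches run instead (see Novelty).

NUMBERS. DW: per_n symmetric size ≥ 2^{εn} i.o. (Thm 7.1, orbit size, char 0; conference version had
2^{n^{1−ε}}); Ryser gives matrix-symmetric
circuits of size O(n² 2^n) (DawarWilsenach2025 §3.3), so the anchor is tight up to the constant in
the exponent; det: transpose-
symmetric circuits constructible in time O(n⁴) (Thm 4.1). HT12: P_c(𝔽)-proofs of the determinant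
identities of polynomial size
(HrubesTzameret2015 main theorem) — the calibration that VP's flagship invariant has short proofs of
its identities. PI proofs:
sound and complete (HrubesTzameret2015 Prop 1.1); k lines on size-s circuits ⇒ size poly(s,k) (Prop
1.2); p-boundedness open
(HrubesTzameret2009 §1). Items at open: 4 (2 cruxes, 1 support, 1 assembly); +2 informal cruxes and
1 definition request after open.

DEFINITION REQUESTS. PIProof (topic Literature/Computability/AlgebraicComplexity): Hrubeš–Tzameret
equational proof systems P_f(𝔽) (fan-in-2 formulas)
and P_c(𝔽) (fan-in-2 circuits) — lines F = G; axioms A1 F=F, A2 F+G=G+F, A3 F+(G+H)=(F+G)+H, A4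
FG=GF, A5 F(GH)=(FG)H, A6
F(G+H)=FG+FH, A7 F+0=F, A8 F·0=0, A9 F·1=F, A10 true constant equations a=b+c, a'=b'c', and C1/C2
(unsharing) for circuits; rules
R1 symmetry, R2 transitivity, R3/R4 congruence; a proof = finite sequence of lines each an axiom
instance or derived from earlier
lines; measures: number of lines, size (sum of sizes of all lines), and per-scheme instance counts
(so that "≤ t instances of A6,
A1–A5/C1/C2 free" is expressible); semantics in MvPolynomial; API: soundness (Prop 1.1, provable),
closure under variable renaming
and substitution (HT12 §1), monotonicity; completeness may be a named fact. Source: arXiv:1112.6265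
§1 (= HrubesTzameret2015),
HrubesTzameret2009. Wanted by items #4, #5. No cite-fact request beyond crux #2 (DW Thm 7.1 is the
crux itself).

Novelty: Searches (2026-08-15; `lit search`/`lit galaxy search`/`lit frontier` local+galaxy daemons returned
rc 75/124 "service unavailable"
throughout the session, OpenAlex 429): `lit search --source arxiv "symmetric circuits permanent
Dawar"` (5: arXiv:2502.06740,
2107.10986, 2002.06451, 2007.07496, 2601.09343 — none mentions proofs or certificates of symmetry,
almost-symmetric circuits or
stability); `lit search --source arxiv "symmetric arithmetic circuits proof complexity invariance"`
(0); `--source arxiv "stability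
approximate automorphism circuit symmetric lower bound"` (0); `--source crossref "proof complexity
polynomial identities symmetric
circuits"` (8: doi:10.1109/ccc.2009.9 HT09, doi:10.1109/focs.2014.20 Grochow–Pitassi IPS,
Grenet–Kaltofen–Koiran–Portier symmetric
determinantal representations doi:10.1090/conm/556/11008 — symmetric MATRICES, unrelated — none
joins symmetric circuits to proof
length); `--source s2 "proof complexity of circuit invariance under permutation symmetric circuits"`
(3; only Babai–Beals–Takácsi-Nagy
"Symmetry and complexity" STOC 1992 doi:10.1145/129712.129754, Boolean circuits with transitive
symmetry, no proofs); full reads: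
DawarWilsenach2025 (ToC pdf, Thms 4.1, 5.1, 6.2–6.4, 7.1–7.2, Defs 2.2, 3.3–3.7, 6.1),
HrubesTzameret2015 §1 (arXiv:1112.6265),
HrubesTzameret2009 §1, §4, DwivediPagoSeppelt2026 Def 1.1 + Outlook; the tree (47 Theses files
grep'd: no symmetric-circuit or
PI-proof route; cards symmetry-restoration-wl, beat-the-group-order, i  [refs: 10.1109/ccc.2009.9, 10.1109/focs.2014.20, 10.1090/conm/556/11008, 10.1145/129712.129754, 2502.06740, 1112.6265, 2601.09343, 1711.10238, doi:10.1109/ccc.2009.9, doi:10.1109/focs.2014.20, doi:10.1090/conm/556/11008, doi:10.1145/129712.129754, DawarWilsenach2025, HrubesTzameret2015, HrubesTzameret2009, DwivediPagoSeppelt2026, DeChiffreGlebskyLubotzkyThom2017]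

Barriers (technique_class: proof-complexity, symmetric-circuits, stability): - technique_class: proof-complexity, symmetric-circuits, stability
- Literature.Barriers.ValiantsHypothesis.PermanentCharTwo: engaged and evaded by construction —
everything is over ℂ: the anchor (DW Thm 7.1) is a characteristic-0 theorem (matrix-symmetric
version needs char ≠ 2), Le Verrier needs char 0, and in characteristic 2 per = det HAS small
symmetric circuits, consistent with RestorationQP; `CharacteristicFreePerNotVP` is never
instantiated.
- Literature.Barriers.ValiantsHypothesis.AlgebraicNaturalProofs: the lower-bound engine is DW's
support theorem + counting-width (bijection-game) argument on CIRCUITS WITH SYMMETRY, not a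
VP-constructible distinguisher vanishing on coefficient vectors of VP; the property "computable by
small symmetric circuits" is not known to be testable from coefficients at all, and the transfer
statements (RestorationQP, L, T) are simulation/proof-theoretic claims outside the distinguisher
format; conceded: if RestorationQP were proved by an explicit symmetrisation procedure nothing
natural-proofs-like is triggered either — the barrier simply does not speak to this line.
- Literature.Barriers.ValiantsHypothesis.NoncommutativeExtensions: not met by the filed items (no
formula-size bound uniform over coefficient rings is claimed); it constrains only the card's unfiled
formula-side fallback (commutator budget), which meters commutations of VARIABLES inside one P_f
proof, not coefficients from an extension ring — recorded so a future K3 route state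

History (route lifecycle, newest last):
- 2026-08-16T02:19:04Z · AUTO-CRUX: 1 conjecture-grade item(s) promoted to crux (PerInvarianceProvableQP) — refuter vetting / tiering apply (operator:999:1362873)
- 2026-08-26T00:47:49Z · DORMANT — reconciler: no traction for 8.2 d (last activity item-evidence-added at 2026-08-17T19:20:05Z); parked, not closed — `ledger route dormant route-ValiantsHypothes (operator:999:3929623)

sub-problem: ValiantsHypothesis · status: dormant · opened planner-plancard-ValiantsHypothesis-ValiantsH-ca71fc49-0 2026-08-15T16:11:18Z · rev 2 · ledger route-ValiantsHypothesis-ProofCarryingSymmetry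
GENERATED by the gate from the ledger (D-0016/17). Provers cite these decls: `theorem foo : Summit.ValiantsHypothesis.ValiantsHypothesis.Theses.ProofCarryingSymmetry.<Decl> := …` in Summits/ValiantsHypothesis/ValiantsHypothesis/Theorems/<Name>.lean.
-/

namespace Summit.ValiantsHypothesis.ValiantsHypothesis.Theses.ProofCarryingSymmetry

open scoped BigOperators Topology Manifold Classical MeasureTheory ProbabilityTheory Matrix InnerProductSpace ComplexConjugate ContinuousMap
open Filter Set Function TopologicalSpace MeasureTheory

attribute [summit_statement] _root_.ValiantsHypothesis

open Literature.PNP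

/-- item stmt-ValiantsHypothesis-10342 · crux · rank 2 · closed · proved by Summit.ValiantsHypothesis.ValiantsHypothesis.Theorems.squareSymmetricPermLB_proof @ c66087af8887 (prover) · by planner
why it might fail: Settled in print (ToC 2025); residual risk is transcription only — DW assume a unique sink and pass via RIGID circuits (rigidification, AndersonDawar2016 Lem 7, is size-linear, orbit-preserving); our IsSymmetric fixes the output gate — each difference only weakens the Lean form.
sources: DawarWilsenach2025, arXiv:2002.06451, AndersonDawar2016, DawarPagoSeppelt2025
[crux] Dawar–Wilsenach's lower bound, size form over ℂ (DawarWilsenach2025 Thm 7.1, which bounds the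
maximal ORBIT size, a quantity ≤ size, so the printed theorem is stronger): for every family (C_n)
of S_n-symmetric labelled arithmetic circuits over ℂ (diagonal action on Fin n × Fin n, trivial on
the single output; DW Defs 2.2, 3.6, 3.7 = tree `LabelledArithCircuit`, `IsSymmetric`) with C_n
computing per_n for every n, the size is not 2^{o(n)}: some ε > 0 has |C_n| ≥ 2^{εn} for infinitely
many n. A published theorem, not yet a Literature fact — filed FIRST so that it lands (as a Theorems
proof or as a named fact the item is then re-filed against) before provers are pointed at the rest.
[difficulty: XL] -/
@[route_item "route-ValiantsHypothesis-ProofCarryingSymmetry", crux]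
def SquareSymmetricPermLB : Prop :=
  ∀ (G : ℕ → Type) [∀ n, Fintype (G n)] (C : ∀ n, Literature.Computability.AlgebraicComplexity.LabelledArithCircuit ℂ (Fin n × Fin n) Unit (G n)), (∀ n, (C n).IsSymmetric (Equiv.Perm (Fin n))) → (∀ n, (C n).eval ((C n).output ()) = Literature.Computability.AlgebraicComplexity.perPoly (Fin n) ℂ) → ∃ ε : ℝ, 0 < ε ∧ ∀ n₀ : ℕ, ∃ n ≥ n₀, (2 : ℝ) ^ (ε * n) ≤ Fintype.card (G n)

/-- item stmt-ValiantsHypothesis-10343 · crux · rank 3 · open · by planner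
why it might fail: An "arithmetic CFI": a diagonally invariant VP family that is not a qp-size combination of bounded-treewidth hom polynomials (DawarPagoSeppelt2025 Thm 1.1) — e.g. a VP family of unbounded-treewidth homs, which DPS26 Cor 3.6 excludes only if VFPT ≠ VW; Boolean precedent P ≠ FPC.
sources: DwivediPagoSeppelt2026, DawarPagoSeppelt2025, DawarWilsenach2025, Engels2020, arXiv:2107.10986
[crux] SYMMETRY RESTORATION AT QUASI-POLYNOMIAL COST (the layer-1 node the card's T ∧ L split;
shared with card symmetry-restoration-wl and DwivediPagoSeppelt2026 Outlook Q3, here for the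
DIAGONAL S_n action and TOTAL size): for every family f_n ∈ ℂ[x_ij : i, j < n] with f_n(x_{σi σj}) =
f_n for all σ ∈ S_n and (f_n) ∈ VP (tree `IsVPFamily`: p-bounded variables/degree and straight-line
complexity), there is c with, for every n, an S_n-symmetric labelled circuit of size ≤ 2^{(log₂ n +
c)^c} computing f_n. [difficulty: open-problem] -/
@[route_item "route-ValiantsHypothesis-ProofCarryingSymmetry", crux]
def RestorationQP : Prop :=
  ∀ f : (n : ℕ) → MvPolynomial (Fin n × Fin n) ℂ, (∀ (n : ℕ) (σ : Equiv.Perm (Fin n)), MvPolynomial.rename (fun x : Fin n × Fin n => σ • x) (f n) = f n) → Literature.Computability.AlgebraicComplexity.IsVPFamily f → ∃ c : ℕ, ∀ n : ℕ, ∃ (G : Type) (_ : Fintype G) (C : Literature.Computability.AlgebraicComplexity.LabelledArithCircuit ℂ (Fin n × Fin n) Unit G), C.IsSymmetric (Equiv.Perm (Fin n)) ∧ C.eval (C.output ()) = f n ∧ Fintype.card G ≤ 2 ^ ((Nat.log 2 n + c) ^ c)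

/-- item stmt-ValiantsHypothesis-10360 · crux (kind.auto-crux: conjecture-grade) · rank 5 · open · by planner
why it might fail: auto-crux — conjecture-grade statement (docstring avows it ('open problem')); it is open, so it may simply be false
sources: conjecture-registry
[crux] PROVABILITY (T_per; card proof-carrying-symmetry K2 — "a small circuit for the permanent
could prove its own symmetry"; UNTYPED until definition item PIProof lands, then set-signature): IF
the permanent family is in VP over ℂ (tree `IsVPFamily (fun n => perPoly (Fin n) ℂ)`), THEN there
are c and fan-in-2 arithmetic circuits C_n over ℂ computing per_n with size ≤ 2^{(log₂ n + c)^c}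
such that for every n and every adjacent transposition τ_k = (k k+1) the invariance identity C_n∘τ_k
= C_n (inputs relabelled x_ij ↦ x_{τ_k i, τ_k j}) has a Hrubeš–Tzameret P_c(ℂ)-proof of size ≤
2^{(log₂ n + c)^c} (HrubesTzameret2015 §1). T_per is the per-instance of T_gen ("every diagonally
S_n-invariant VP family has quasi-polynomial circuits with quasi-polynomial P_c-proofs of their n−1
generator invariances"), which is implied by quasi-polynomial boundedness of P_c(ℂ) on true circuit
identities (the central open problem of algebraic proof complexity, HrubesTzameret2009 §1) and,
given StabilityOfProvableSymmetry, is equivalent to RestorationQP (DwivediPagoSeppelt2026 Outlook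
Q3). With StabilityOfProvableSymmetry and SquareSymmetricPermLB this item gives ¬IsVPFamily per
directly (foreseen suppor -/
@[route_item "route-ValiantsHypothesis-ProofCarryingSymmetry", crux]
def PerInvarianceProvableQP : Prop :=
  Literature.Computability.AlgebraicComplexity.IsVPFamily (fun n => Literature.Computability.AlgebraicComplexity.perPoly (Fin n) ℂ) → ∃ c : ℕ, ∀ n : ℕ, ∃ C : Literature.Computability.AlgebraicComplexity.PICircuit ℂ (Fin n × Fin n), C.eval = Literature.Computability.AlgebraicComplexity.perPoly (Fin n) ℂ ∧ C.size ≤ 2 ^ ((Nat.log 2 n + c) ^ c) ∧ ∀ (k : ℕ) (hk : k + 1 < n), Literature.Computability.AlgebraicComplexity.HasPCProofOfSize (C.rename (fun x : Fin n × Fin n => (Equiv.swap (⟨k, Nat.lt_of_succ_lt hk⟩ : Fin n) ⟨k + 1, hk⟩) • x)) C (2 ^ ((Nat.log 2 n + c) ^ c))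

-- item stmt-ValiantsHypothesis-10358 · support · rank 4 · open · by planner — informal only, no Lean statement yet:
--   [crux] STABILITY OF PROVABLE SYMMETRY (L; card proof-carrying-symmetry K1 — the route's bet; UNTYPED
--   until definition item PIProof lands, then set-signature): there is an absolute constant c such that
--   for all n, s, t and every fan-in-2 arithmetic circuit C over ℂ in the variables x_ij (i, j < n) of
--   size s computing f, IF for every adjacent transposition τ_k = (k k+1) ∈ S_n (k+1 < n) the identity
--   C∘τ_k = C — where C∘τ_k is C with its input labels relabelled x_ij ↦ x_{τ_k i, τ_k j} — has a
--   Hrubeš–Tzameret P_c(ℂ)-proof of size ≤ t (HrubesTzameret2015 §1: axioms A1–A10, C1–C2, rules R1–R4,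
--   size =

/-- item stmt-ValiantsHypothesis-10344 · support · rank 9 · closed · proved by Summit.ValiantsHypothesis.ValiantsHypothesis.Theorems.detCalibration_proof (prover) · by planner
sources: DawarWilsenach2025, arXiv:2002.06451
[support] CALIBRATION / NON-VACUITY (DawarWilsenach2025 Thm 4.1, Le Verrier's method;
transpose-symmetric ⊇ diagonal): det_n has S_n-symmetric labelled circuits over ℂ of size polynomial
in n (the paper's family is computable in time O(n⁴)). Shows the symmetric model is inhabited by a
VP-complete-flavoured invariant family exactly where restoration can be checked, and exercises
`IsSymmetric` with ℚ-constants 1/k. [difficulty: M] -/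
@[route_item "route-ValiantsHypothesis-ProofCarryingSymmetry", crux]
def DetCalibration : Prop :=
  ∃ c : ℕ, ∀ n : ℕ, ∃ (G : Type) (_ : Fintype G) (C : Literature.Computability.AlgebraicComplexity.LabelledArithCircuit ℂ (Fin n × Fin n) Unit G), C.IsSymmetric (Equiv.Perm (Fin n)) ∧ C.eval (C.output ()) = Literature.Computability.AlgebraicComplexity.detPoly (Fin n) ℂ ∧ Fintype.card G ≤ (n + 2) ^ c

/-- item stmt-ValiantsHypothesis-10345 · assembly · rank 1 · closed · proved by Summit.ValiantsHypothesis.Theorems.ProofCarryingSymmetry.Assembly_proof @ d8574088b2c8 (prover) · by planner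
sources: Valiant1979, Burgisser2000, DawarWilsenach2025
[assembly] SquareSymmetricPermLB → RestorationQP → ValiantsHypothesis (per is diagonally invariant
and in VNP; quasi-polynomial is 2^{o(n)}; hub lemma). -/
@[route_item "route-ValiantsHypothesis-ProofCarryingSymmetry", crux]
def Assembly : Prop :=
  SquareSymmetricPermLB → RestorationQP → _root_.ValiantsHypothesis

/-! D-0027 §2.1 — DECIDING THEOREM (planner-authored via `route open/edit --closes-file`; by planner-plancard-ValiantsHypothesis-ValiantsH-ca71fc49-0 2026-08-15T16:11:18Z):
its hypotheses are this route's items and its conclusion the sub-problem Statement (glue_lint), and it elaborates with this file. -/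

@[closes "route-ValiantsHypothesis-ProofCarryingSymmetry"] theorem closes : SquareSymmetricPermLB → RestorationQP → DetCalibration → Assembly → _root_.ValiantsHypothesis := fun h_SquareSymmetricPermLB h_RestorationQP _h_DetCalibration h_Assembly => h_Assembly h_SquareSymmetricPermLB h_RestorationQP

end Summit.ValiantsHypothesis.ValiantsHypothesis.Theses.ProofCarryingSymmetry
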